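import Summits.Ventures.PercRepro.S1CoreCapSixCost

/-!
# PercRepro — TOWARDS `Q*(7) = 19`: THE PLANE OF A CONFIGURATION AND THE PAIR BOUND (p1, gen 26)

The device for the cases without big lines at nullity `7`, where the counting lemma of `S1CoreCapFreeSeq` alone
is too weak (`2 · #T ≤ 6 · 7` over a line gives `22 > 19`). A PLANE of a configuration is a maximal duplicate-free
list `l` of its lines with `lineRank l ≤ 3` (`exists_plane`, from any such list, e.g. two meeting lines): every
line not in `l` meets `unionL l` in at most one point (a line with two old points would extend `l` at no rank
cost), and the plane clause gives `|unionL l| ≤ 9` (`card_plane_le_nine`). Inside the plane the lines are bounded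
by PAIRS — distinct lines share at most one point, so their 2-subsets are disjoint and
`Σ_L C(|L|, 2) ≤ C(|∪|, 2)` (`sum_choose_two_le`, `three_mul_card_le_choose_two` for 3-point lines); outside
it the lines have the free budget `10 − |unionL l|` over the plane (`budget_over_plane`) and the counting lemma
applies. For a configuration of simple 3-point lines this gives `#lines ≤ 18` (`card_le_eighteen_of_simple`): by
`|plane| = 5 … 9`, `3 + 15`, `5 + 10`, `7 + 6`, `9 + 3`, `12 + 1` lines; and `≤ 7` lines when no two lines meet
(`card_le_seven_of_pairwise_disjoint`). `proofs/P1-S4-CAPBRIDGE.md` §18. Axioms: standard.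
-/

namespace PercRepro

namespace S1

namespace FourCap

namespace Seven

variable {β : Type} [DecidableEq β]

/-! ### The plane: a maximal list of rank `≤ 3` -/

/-- Adding a line with at least two old points does not raise `lineRank`. -/
theorem lineRank_cons_of_two_le (L : Finset β) (l : List (Finset β)) (h : 2 ≤ (L ∩ unionL l).card) :
    lineRank (L :: l) = lineRank l := by
  simp only [lineRank]
  have : 2 - min (L ∩ unionL l).card 2 = 0 := by omega
  rw [this]
  simp

/-- **A plane exists**: any duplicate-free list `l₀` of lines of `ls` with `lineRank l₀ ≤ 3` extends to one, `l`,
such that every line of `ls` not in `l` meets `unionL l` in at most one point (a line with two old points would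
extend the list at no rank cost). -/
theorem exists_plane (ls : Finset (Finset β)) :
    ∀ (m : ℕ) (l₀ : List (Finset β)), (ls.filter (fun L => L ∉ l₀)).card ≤ m → l₀.Nodup →
      (∀ L ∈ l₀, L ∈ ls) → lineRank l₀ ≤ 3 →
      ∃ l : List (Finset β), l.Nodup ∧ (∀ L ∈ l, L ∈ ls) ∧ lineRank l ≤ 3 ∧ (∀ L ∈ l₀, L ∈ l) ∧
        ∀ L ∈ ls, L ∉ l → (L ∩ unionL l).card ≤ 1
  | 0, l₀, hm, hnd, hls, hr => by
    refine ⟨l₀, hnd, hls, hr, fun L hL => hL, fun L hL hLl => ?_⟩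
    exfalso
    have : L ∈ ls.filter (fun L => L ∉ l₀) := Finset.mem_filter.2 ⟨hL, hLl⟩
    rw [Finset.card_eq_zero.1 (Nat.le_zero.1 hm)] at this
    exact Finset.notMem_empty L this
  | m + 1, l₀, hm, hnd, hls, hr => by
    by_cases hex : ∃ L ∈ ls, L ∉ l₀ ∧ 2 ≤ (L ∩ unionL l₀).card
    · obtain ⟨L, hL, hLl, hold⟩ := hex
      have hsub : ls.filter (fun L' => L' ∉ L :: l₀) ⊆ (ls.filter (fun L' => L' ∉ l₀)).erase L := by
        intro L' hL'
        have h' := Finset.mem_filter.1 hL'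
        simp only [List.mem_cons, not_or] at h'
        exact Finset.mem_erase.2 ⟨h'.2.1, Finset.mem_filter.2 ⟨h'.1, h'.2.2⟩⟩
      have hcard : (ls.filter (fun L' => L' ∉ L :: l₀)).card ≤ m := by
        refine (Finset.card_le_card hsub).trans ?_
        rw [Finset.card_erase_of_mem (Finset.mem_filter.2 ⟨hL, hLl⟩)]
        omega
      obtain ⟨l, hnd', hls', hr', hsub', hmax⟩ := exists_plane ls m (L :: l₀) hcard (List.nodup_cons.2 ⟨hLl, hnd⟩)
        (fun L' hL' => by
          rcases List.mem_cons.1 hL' with rfl | hL'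
          · exact hL
          · exact hls L' hL')
        (by rw [lineRank_cons_of_two_le L l₀ hold]; exact hr)
      exact ⟨l, hnd', hls', hr', fun L' hL' => hsub' L' (List.mem_cons_of_mem _ hL'), hmax⟩
    · push Not at hex
      exact ⟨l₀, hnd, hls, hr, fun L hL => hL, fun L hL hLl => by have := hex L hL hLl; omega⟩

/-- Two distinct meeting lines form a list of `lineRank 3` (for lines of `≥ 2` points). -/
theorem lineRank_pair_eq_three {L₁ L₂ : Finset β} (h2 : 2 ≤ L₁.card) (h2' : 2 ≤ L₂.card)
    (hint : (L₂ ∩ L₁).card = 1) : lineRank [L₂, L₁] = 3 := by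
  simp only [lineRank, unionL, Finset.union_empty, Finset.sdiff_empty, Finset.inter_empty, Finset.card_empty,
    Nat.zero_add, hint]
  have := Finset.card_sdiff_add_card_inter L₂ L₁
  omega

/-- A plane built on two meeting lines has at least five points. -/
theorem five_le_card_plane {L₁ L₂ : Finset β} (h3 : 3 ≤ L₁.card) (h3' : 3 ≤ L₂.card)
    (hint : (L₂ ∩ L₁).card ≤ 1) {l : List (Finset β)} (hL₁ : L₁ ∈ l) (hL₂ : L₂ ∈ l) :
    5 ≤ (unionL l).card := by
  have hsub : L₂ ∪ L₁ ⊆ unionL l := by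
    intro v hv
    rcases Finset.mem_union.1 hv with h | h
    · exact mem_unionL_iff.2 ⟨L₂, hL₂, h⟩
    · exact mem_unionL_iff.2 ⟨L₁, hL₁, h⟩
  have := Finset.card_le_card hsub
  have := Finset.card_union_add_card_inter L₂ L₁
  omega

/-! ### The pair bound -/

/-- The 2-subsets of two lines sharing at most one point are disjoint. -/
theorem disjoint_powersetCard_two {L L' : Finset β} (h : (L ∩ L').card ≤ 1) :
    Disjoint (L.powersetCard 2) (L'.powersetCard 2) := by
  rw [Finset.disjoint_left]
  intro p hp hp'
  have h1 := Finset.mem_powersetCard.1 hp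
  have h2 := Finset.mem_powersetCard.1 hp'
  have : p ⊆ L ∩ L' := Finset.subset_inter h1.1 h2.1
  have := Finset.card_le_card this
  omega

/-- **The pair bound**: lines of a family sharing pairwise at most one point have `Σ_L C(|L|, 2) ≤ C(|∪|, 2)`. -/
theorem sum_choose_two_le (T : Finset (Finset β)) (hpair : ∀ L ∈ T, ∀ L' ∈ T, L ≠ L' → (L ∩ L').card ≤ 1) :
    ∑ L ∈ T, L.card.choose 2 ≤ (T.biUnion id).card.choose 2 := by
  have hdisj : ∀ L ∈ T, ∀ L' ∈ T, L ≠ L' → Disjoint (L.powersetCard 2) (L'.powersetCard 2) :=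
    fun L hL L' hL' hne => disjoint_powersetCard_two (hpair L hL L' hL' hne)
  have hcard := Finset.card_biUnion hdisj
  simp only [Finset.card_powersetCard] at hcard
  rw [← hcard, ← Finset.card_powersetCard]
  refine Finset.card_le_card ?_
  intro p hp
  obtain ⟨L, hL, hpL⟩ := Finset.mem_biUnion.1 hp
  have h := Finset.mem_powersetCard.1 hpL
  exact Finset.mem_powersetCard.2 ⟨h.1.trans (Finset.subset_biUnion_of_mem id hL), h.2⟩

/-- The union of the lines of a list, as a `biUnion` of its finset. -/
theorem unionL_eq_biUnion (l : List (Finset β)) : unionL l = l.toFinset.biUnion id := by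
  ext v
  rw [mem_unionL_iff, Finset.mem_biUnion]
  simp only [List.mem_toFinset, id_eq]

/-- **The pair bound for a list of 3-point lines**: `3 · length ≤ C(|unionL l|, 2)`. -/
theorem three_mul_length_le_choose_two (l : List (Finset β)) (hnd : l.Nodup) (h3 : ∀ L ∈ l, L.card = 3)
    (hpair : ∀ L ∈ l, ∀ L' ∈ l, L ≠ L' → (L ∩ L').card ≤ 1) :
    3 * l.length ≤ (unionL l).card.choose 2 := by
  have h := sum_choose_two_le l.toFinset (fun L hL L' hL' hne =>
    hpair L (List.mem_toFinset.1 hL) L' (List.mem_toFinset.1 hL') hne)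
  rw [← unionL_eq_biUnion] at h
  have hsum : ∑ L ∈ l.toFinset, L.card.choose 2 = 3 * l.length := by
    rw [Finset.sum_const_nat (m := 3) (fun L hL => by rw [h3 L (List.mem_toFinset.1 hL)]; decide),
      List.toFinset_card_of_nodup hnd, Nat.mul_comm]
  omega

/-! ### The budget over the plane and the simple case -/

section Plane

variable {w : β → ℕ} {ls : Finset (Finset β)}
  (h1 : ∀ L ∈ ls, ∀ v ∈ L, w v = 1 ∨ w v = 2)
  (h2 : ∀ L ∈ ls, 3 ≤ L.card ∧ wsum w L ≤ 5)
  (h3 : ∀ L ∈ ls, ∀ L' ∈ ls, L ≠ L' → (L ∩ L').card ≤ 1)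
  (h4 : ∀ l : List (Finset β), l.Nodup → (∀ L ∈ l, L ∈ ls) → wsum w (unionL l) ≤ 7 + lineRank l)
  (h5 : ∀ l : List (Finset β), l.Nodup → (∀ L ∈ l, L ∈ ls) → lineRank l ≤ 3 → (unionL l).card ≤ 9)

omit [DecidableEq β] in
/-- Lines of the spec have at least two points. -/
theorem two_le_card_of_spec₇ (h2 : ∀ L ∈ ls, 3 ≤ L.card ∧ wsum w L ≤ 5) : ∀ L ∈ ls, 2 ≤ L.card :=
  fun L hL => le_trans (by omega : 2 ≤ 3) (h2 L hL).1

include h5 in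
/-- **A plane has at most nine points** (the plane clause). -/
theorem card_plane_le_nine {l : List (Finset β)} (hnd : l.Nodup) (hls : ∀ L ∈ l, L ∈ ls) (hr : lineRank l ≤ 3) :
    (unionL l).card ≤ 9 :=
  h5 l hnd hls hr

omit [DecidableEq β] in
/-- A set of points of weight one has no fat point. -/
theorem fat_eq_zero_of_weight_one {S : Finset β} (hw : ∀ v ∈ S, w v = 1) : fat w S = 0 := by
  unfold fat
  rw [Finset.card_eq_zero, Finset.filter_eq_empty_iff]
  intro v hv h
  have := hw v hv
  omega

omit [DecidableEq β] in
/-- The weight of a set of simple points is its number of points. -/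
theorem wsum_eq_card_of_weight_one {S : Finset β} (hw : ∀ v ∈ S, w v = 1) : wsum w S = S.card := by
  unfold wsum
  rw [Finset.card_eq_sum_ones]
  exact Finset.sum_congr rfl hw

include h1 h2 h4 in
/-- **The free budget over a plane, simple case**: with every point of weight one, a list `t` of 3-point lines of
`ls` outside a list `l` with `lineRank l ≤ 3` has at most `10 − |unionL l|` free lines over `unionL l`. -/
theorem budget_over_plane (hw : ∀ L ∈ ls, ∀ v ∈ L, w v = 1) {l : List (Finset β)} (hr : lineRank l ≤ 3)
    (t : List (Finset β)) (hnd : (t ++ l).Nodup) (hls : ∀ L ∈ t ++ l, L ∈ ls) (h3t : ∀ L ∈ t, L.card = 3) :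
    freeCountR (unionL l) t + (unionL l).card ≤ 10 := by
  have hb := budget_of_prefix h1 (two_le_card_of_spec₇ h2) h4 l t hnd hls h3t
  have hl : ∀ L ∈ l, L ∈ ls := fun L hL => hls L (List.mem_append_right _ hL)
  have hwl : ∀ v ∈ unionL l, w v = 1 := fun v hv => by
    obtain ⟨L, hL, hvL⟩ := mem_unionL_iff.1 hv
    exact hw L (hl L hL) v hvL
  have hc := wsum_unionL_eq w l (fun L hL => h1 L (hl L hL)) (fun L hL => two_le_card_of_spec₇ h2 L (hl L hL))
  rw [wsum_eq_card_of_weight_one hwl] at hc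
  have hf0 : fat w (unionL l) = 0 := fat_eq_zero_of_weight_one hwl
  have hf0' : fat w (unionLR (unionL l) t) = 0 := fat_eq_zero_of_weight_one (fun v hv => by
    rcases mem_unionLR_iff.1 hv with hv | ⟨L, hL, hvL⟩
    · exact hwl v hv
    · exact hw L (hls L (List.mem_append_left _ hL)) v hvL)
  omega

include h1 h2 h4 in
/-- **Pairwise disjoint lines number at most `7`**: each is free in any order. -/
theorem card_le_seven_of_pairwise_disjoint (hall : ∀ L ∈ ls, L.card = 3)
    (hdisj : ∀ L ∈ ls, ∀ L' ∈ ls, L ≠ L' → (L ∩ L').card = 0) : ls.card ≤ 7 := by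
  have hfree : ∀ t : List (Finset β), t.Nodup → (∀ L ∈ t, L ∈ ls) → freeCountR ∅ t = t.length := by
    intro t
    induction t with
    | nil => intros; rfl
    | cons L t ih =>
      intro hnd hls
      have hL := hls L List.mem_cons_self
      have hsd : 0 < L.card := by rw [hall L hL]; omega
      obtain ⟨v, hv⟩ := Finset.card_pos.1 hsd
      rw [freeCountR_cons_of_new hv (Finset.notMem_empty v) (fun L' hL' hvL' => by
        have hne : L ≠ L' := fun h => (List.nodup_cons.1 hnd).1 (h ▸ hL')
        have := hdisj L hL L' (hls L' (List.mem_cons_of_mem _ hL')) hne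
        rw [Finset.card_eq_zero] at this
        exact Finset.notMem_empty v (this ▸ Finset.mem_inter.2 ⟨hv, hvL'⟩)),
        ih (List.nodup_cons.1 hnd).2 (fun L' hL' => hls L' (List.mem_cons_of_mem _ hL'))]
      rfl
  have hb := budget_of_prefix h1 (two_le_card_of_spec₇ h2) h4 [] ls.toList (by simpa using Finset.nodup_toList ls)
    (fun L hL => by simpa using hL) (fun L hL => hall L (Finset.mem_toList.1 hL))
  simp only [unionL, costSum, Nat.zero_add] at hb
  rw [hfree ls.toList (Finset.nodup_toList ls) (fun L hL => Finset.mem_toList.1 hL), Finset.length_toList] at hb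
  have : fat w (unionL ([] : List (Finset β))) = 0 := by simp [unionL, fat]
  simp only [unionL] at this
  omega

include h1 h2 h3 h4 h5 in
/-- **A configuration of simple 3-point lines at nullity `7` has at most `18` lines**: either no two lines meet
(`≤ 7`), or a plane on two meeting lines has `c = 5 … 9` points, at most `C(c, 2) / 3` lines inside it and the
counting lemma at budget `10 − c` outside it: `3 + 15`, `5 + 10`, `7 + 6`, `9 + 3`, `12 + 1`. -/
theorem card_le_eighteen_of_simple (hall : ∀ L ∈ ls, L.card = 3) (hw : ∀ L ∈ ls, ∀ v ∈ L, w v = 1) :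
    ls.card ≤ 18 := by
  by_cases hmeet : ∃ L₁ ∈ ls, ∃ L₂ ∈ ls, L₂ ≠ L₁ ∧ (L₂ ∩ L₁).card = 1
  · obtain ⟨L₁, hL₁, L₂, hL₂, hne, hint⟩ := hmeet
    have h2' := two_le_card_of_spec₇ h2
    obtain ⟨l, hnd, hls, hr, hsub, hmax⟩ := exists_plane ls _ [L₂, L₁] le_rfl (by simp [hne])
      (by simp [hL₁, hL₂]) (by rw [lineRank_pair_eq_three (h2' L₁ hL₁) (h2' L₂ hL₂) hint])
    have hc9 : (unionL l).card ≤ 9 := card_plane_le_nine h5 hnd hls hr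
    have hc5 : 5 ≤ (unionL l).card := five_le_card_plane (h2 L₁ hL₁).1 (h2 L₂ hL₂).1 hint.le (hsub L₁ (by simp))
      (hsub L₂ (by simp))
    -- inside the plane: the pair bound
    have hin : 3 * l.length ≤ (unionL l).card.choose 2 := three_mul_length_le_choose_two l hnd
      (fun L hL => hall L (hls L hL)) (fun L hL L' hL' hne => h3 L (hls L hL) L' (hls L' hL') hne)
    -- outside the plane: the counting lemma at budget `10 − |P₀|`
    set T := ls.filter (fun L => L ∉ l) with hT
    have hTmem : ∀ L ∈ T, L ∈ ls ∧ L ∉ l := fun L hL => Finset.mem_filter.1 hL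
    have hout : 2 * T.card ≤ (10 - (unionL l).card) * (10 - (unionL l).card + 1) := by
      refine two_mul_card_le_of_freeCountR (unionL l) (10 - (unionL l).card) T
        (fun L hL => ⟨hall L (hTmem L hL).1, hmax L (hTmem L hL).1 (hTmem L hL).2⟩)
        (fun L hL L' hL' hne => h3 L (hTmem L hL).1 L' (hTmem L' hL').1 hne) ?_
      intro t hndt hlt
      have hb := budget_over_plane h1 h2 h4 hw hr t (by
        rw [List.nodup_append']
        exact ⟨hndt, hnd, fun L hLt hLl => (hTmem L (hlt L hLt)).2 hLl⟩)
        (fun L hL => by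
          rcases List.mem_append.1 hL with hL | hL
          · exact (hTmem L (hlt L hL)).1
          · exact hls L hL)
        (fun L hL => hall L (hTmem L (hlt L hL)).1)
      omega
    -- the split
    have hsplit : ls.card = l.length + T.card := by
      have h := Finset.card_filter_add_card_filter_not (s := ls) (fun L => L ∈ l)
      have hl : (ls.filter (fun L => L ∈ l)).card = l.length := by
        rw [← List.toFinset_card_of_nodup hnd]
        congr 1
        ext L
        simp only [Finset.mem_filter, List.mem_toFinset]
        exact ⟨fun h => h.2, fun h => ⟨hls L h, h⟩⟩
      rw [← h, hl]
    rw [hsplit]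
    rw [Nat.choose_two_right] at hin
    have hc : (unionL l).card = 5 ∨ (unionL l).card = 6 ∨ (unionL l).card = 7 ∨ (unionL l).card = 8 ∨
        (unionL l).card = 9 := by omega
    rcases hc with hc | hc | hc | hc | hc <;> rw [hc] at hin hout <;> omega
  · push Not at hmeet
    refine card_le_seven_of_pairwise_disjoint h1 h2 h4 hall (fun L hL L' hL' hne => ?_) |>.trans (by omega)
    rw [Finset.inter_comm]
    have := h3 L' hL' L hL hne.symm
    have := hmeet L hL L' hL' hne.symm
    omega

include h1 h2 h3 h4 h5 in
/-- **The cap sum of a configuration of simple 3-point lines at nullity `7` is at most `18`**. -/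
theorem sum_cap_le_eighteen_of_simple (hall : ∀ L ∈ ls, L.card = 3) (hw : ∀ L ∈ ls, ∀ v ∈ L, w v = 1) :
    ∑ L ∈ ls, capPaper L.card (fat w L) ≤ 18 := by
  have : ∀ L ∈ ls, capPaper L.card (fat w L) = 1 := by
    intro L hL
    rw [hall L hL, fat_eq_zero_of_weight_one (hw L hL)]
    rfl
  have h := card_le_eighteen_of_simple h1 h2 h3 h4 h5 hall hw
  rw [Finset.card_eq_sum_ones] at h
  rw [Finset.sum_congr rfl this]
  exact h

end Plane

end Seven

end FourCap

end S1

end PercRepro
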